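import Summits.ValiantsHypothesis.ValiantsHypothesis.Theorems.BinomialElusivePeelingLemmaSchottkyDefs

/-!
# A free subgroup of `SL(2,ℤ)` of any finite rank, by Schottky ping-pong (module [G], part 1)

Helper for the crux stmt-ValiantsHypothesis-7391 (negative lane; `Cruxes/PeelingLemma/DETERMINISTIC-ALLX.md`
§5).  For the generators `gen D j = T(4(j+1))` of `BinomialElusivePeelingLemmaSchottkyDefs.lean`
acting on nonzero integer vectors: the adapted-coordinate action (`adapted_smul`, `snd_smul`, and
for the inverses), the two arithmetic cores of the table-tennis (`coneX_core`, `coneY_core`), cone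
separation (`eq_zero_of_two_cones`, `disjoint_of_far`), the six hypotheses of Mathlib's
`FreeGroup.injective_lift_of_ping_pong`, and the conclusion `injective_lift_gen`:
`FreeGroup.lift (gen D) : FreeGroup (Fin D) →* SL(2,ℤ)` is injective for `D ≥ 2`.  This is the
freeness half of the elementary high-girth Cayley graphs (Margulis; Davidoff–Sarnak–Valette App. A);
the girth half (entry growth + reduction mod `p`) is part 2.  No Theses import.
-/

namespace Summit.ValiantsHypothesis.ValiantsHypothesis.Theorems.PeelingLemmaSchottky

-- summit = sub-problem name (single-conjunct summit, D-0017 layout), so the namespace repeats it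
set_option linter.dupNamespace false

open Matrix
open scoped Pointwise

/-! ## The generators in adapted coordinates -/

/-- `T(m)` preserves the adapted coordinate `x' = x - m y`. -/
theorem adapted_smul (m : ℤ) (v : Fin 2 → ℤ) : adapted m (genMat m • v) = adapted m v := by
  simp [adapted, Matrix.SpecialLinearGroup.smul_def, genMat, Matrix.mulVec, dotProduct,
    Fin.sum_univ_two]
  ring

/-- `T(m)` adds `2x'` to the second coordinate. -/
theorem snd_smul (m : ℤ) (v : Fin 2 → ℤ) : (genMat m • v) 1 = v 1 + 2 * adapted m v := by
  simp [adapted, Matrix.SpecialLinearGroup.smul_def, genMat, Matrix.mulVec, dotProduct,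
    Fin.sum_univ_two]
  ring

/-- `T(m)⁻¹` preserves the adapted coordinate. -/
theorem adapted_inv_smul (m : ℤ) (v : Fin 2 → ℤ) : adapted m ((genMat m)⁻¹ • v) = adapted m v := by
  simp [adapted, Matrix.SpecialLinearGroup.smul_def, Matrix.SpecialLinearGroup.coe_inv, genMat,
    Matrix.mulVec, dotProduct, Fin.sum_univ_two, Matrix.adjugate_fin_two]
  ring

/-- `T(m)⁻¹` subtracts `2x'` from the second coordinate. -/
theorem snd_inv_smul (m : ℤ) (v : Fin 2 → ℤ) :
    ((genMat m)⁻¹ • v) 1 = v 1 - 2 * adapted m v := by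
  simp [adapted, Matrix.SpecialLinearGroup.smul_def, Matrix.SpecialLinearGroup.coe_inv, genMat,
    Matrix.mulVec, dotProduct, Fin.sum_univ_two, Matrix.adjugate_fin_two]
  ring

/-! ## The two arithmetic cores of the ping-pong -/

/-- Core of `T(m) • (Y m)ᶜ ⊆ X m`: outside the negative half-cone, adding `2x'` to `y` lands in the
positive half-cone. -/
theorem coneX_core (x y : ℤ) (hx : x ≠ 0) (h : |y| < |x| ∨ (|x| ≤ |y| ∧ 0 ≤ x * y)) :
    |x| ≤ |y + 2 * x| ∧ 0 < x * (y + 2 * x) := by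
  rcases lt_or_gt_of_ne hx with hneg | hpos
  · rw [abs_of_neg hneg] at h ⊢
    have hy : y + 2 * x < 0 ∧ -x ≤ -(y + 2 * x) := by
      rcases h with h | ⟨h1, h2⟩
      · have := abs_lt.mp h; constructor <;> linarith [this.1, this.2]
      · have hy0 : y ≤ 0 := by nlinarith
        have : |y| = -y := abs_of_nonpos hy0
        rw [this] at h1; constructor <;> linarith
    rw [abs_of_neg hy.1]
    exact ⟨hy.2, by nlinarith [hy.1]⟩
  · rw [abs_of_pos hpos] at h ⊢
    have hy : 0 < y + 2 * x ∧ x ≤ y + 2 * x := by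
      rcases h with h | ⟨h1, h2⟩
      · have := abs_lt.mp h; constructor <;> linarith [this.1, this.2]
      · have hy0 : 0 ≤ y := by nlinarith
        have : |y| = y := abs_of_nonneg hy0
        rw [this] at h1; constructor <;> linarith
    rw [abs_of_pos hy.1]
    exact ⟨hy.2, by nlinarith [hy.1]⟩

/-- Core of `T(m)⁻¹ • (X m)ᶜ ⊆ Y m`: outside the positive half-cone and off the fixed line,
subtracting `2x'` from `y` lands in the negative half-cone. -/
theorem coneY_core (x y : ℤ) (hx : x ≠ 0) (h : |y| < |x| ∨ (|x| ≤ |y| ∧ x * y ≤ 0)) :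
    |x| ≤ |y - 2 * x| ∧ x * (y - 2 * x) < 0 := by
  rcases lt_or_gt_of_ne hx with hneg | hpos
  · rw [abs_of_neg hneg] at h ⊢
    have hy : 0 < y - 2 * x ∧ -x ≤ y - 2 * x := by
      rcases h with h | ⟨h1, h2⟩
      · have := abs_lt.mp h; constructor <;> linarith [this.1, this.2]
      · have hy0 : 0 ≤ y := by nlinarith
        have : |y| = y := abs_of_nonneg hy0
        rw [this] at h1; constructor <;> linarith
    rw [abs_of_pos hy.1]
    exact ⟨hy.2, by nlinarith [hy.1]⟩
  · rw [abs_of_pos hpos] at h ⊢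
    have hy : y - 2 * x < 0 ∧ x ≤ -(y - 2 * x) := by
      rcases h with h | ⟨h1, h2⟩
      · have := abs_lt.mp h; constructor <;> linarith [this.1, this.2]
      · have hy0 : y ≤ 0 := by nlinarith
        have : |y| = -y := abs_of_nonpos hy0
        rw [this] at h1; constructor <;> linarith
    rw [abs_of_neg hy.1]
    exact ⟨hy.2, by nlinarith [hy.1]⟩

/-! ## Cone separation -/

/-- Two cones `|x - m y| ≤ |y|`, `|x - m' y| ≤ |y|` with `|m - m'| ≥ 3` meet only at `0`. -/
theorem eq_zero_of_two_cones {m m' : ℤ} (hmm : 3 ≤ |m - m'|) (v : Fin 2 → ℤ)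
    (h1 : |adapted m v| ≤ |v 1|) (h2 : |adapted m' v| ≤ |v 1|) : v = 0 := by
  have hdiff : adapted m' v - adapted m v = (m - m') * v 1 := by simp only [adapted]; ring
  have h3 : |m - m'| * |v 1| ≤ 2 * |v 1| := by
    rw [← abs_mul, ← hdiff]
    calc |adapted m' v - adapted m v| ≤ |adapted m' v| + |adapted m v| := abs_sub _ _
      _ ≤ 2 * |v 1| := by linarith
  have hv1 : v 1 = 0 := by
    have : |v 1| ≤ 0 := by nlinarith [abs_nonneg (v 1)]
    exact abs_eq_zero.mp (le_antisymm this (abs_nonneg _))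
  have hv0 : v 0 = 0 := by
    have : |adapted m v| ≤ 0 := by rw [hv1, abs_zero] at h1; exact h1
    have h0 : adapted m v = 0 := abs_eq_zero.mp (le_antisymm this (abs_nonneg _))
    simp only [adapted, hv1, mul_zero, sub_zero] at h0
    exact h0
  ext i; fin_cases i <;> simp [hv0, hv1]

/-- Every element of `X m` or `Y m` lies in the cone of `m`. -/
theorem inCone_of_mem {m : ℤ} (v : nonzeroSub) (h : v ∈ coneX m ∨ v ∈ coneY m) :
    |adapted m v.1| ≤ |v.1 1| := by
  rcases h with (⟨h, -⟩ | h) | ⟨h, -⟩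
  · exact h
  · rw [h, abs_zero]; exact abs_nonneg _
  · exact h

/-- Cones of far-apart generators are disjoint (in nonzero vectors). -/
theorem disjoint_of_far {m m' : ℤ} (hmm : 3 ≤ |m - m'|) (S T : Set nonzeroSub)
    (hS : S = coneX m ∨ S = coneY m) (hT : T = coneX m' ∨ T = coneY m') : Disjoint S T := by
  rw [Set.disjoint_left]
  intro v hvS hvT
  have h1 : |adapted m v.1| ≤ |v.1 1| :=
    inCone_of_mem v (by rcases hS with rfl | rfl <;> simp [hvS])
  have h2 : |adapted m' v.1| ≤ |v.1 1| :=
    inCone_of_mem v (by rcases hT with rfl | rfl <;> simp [hvT])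
  exact v.2 (eq_zero_of_two_cones hmm v.1 h1 h2)

/-- `X m` and `Y m` are disjoint. -/
theorem disjoint_coneX_coneY_self (m : ℤ) : Disjoint (coneX m) (coneY m) := by
  rw [Set.disjoint_left]
  rintro v (⟨-, h1⟩ | h1) ⟨-, h2⟩
  · linarith
  · rw [h1, zero_mul] at h2; exact lt_irrefl _ h2

/-! ## The ping-pong hypotheses -/

/-- `X m` is nonempty: it contains the fixed vector `(m, 1)`. -/
theorem coneX_nonempty (m : ℤ) : (coneX m).Nonempty := by
  refine ⟨⟨![m, 1], ?_⟩, Or.inr ?_⟩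
  · show (![m, 1] : Fin 2 → ℤ) ≠ 0
    intro h; have := congrFun h 1; simp at this
  · simp [adapted]

/-- `T(m) • (Y m)ᶜ ⊆ X m`. -/
theorem smul_compl_coneY_subset (m : ℤ) : genMat m • (coneY m)ᶜ ⊆ coneX m := by
  rintro _ ⟨v, hv, rfl⟩
  simp only [Set.mem_compl_iff, coneY, Set.mem_setOf_eq, not_and, not_lt] at hv
  show (|adapted m (genMat m • v).1| ≤ |(genMat m • v).1 1| ∧
      0 < adapted m (genMat m • v).1 * (genMat m • v).1 1) ∨ adapted m (genMat m • v).1 = 0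
  rw [SubMulAction.val_smul, adapted_smul, snd_smul]
  by_cases hx : adapted m v.1 = 0
  · exact Or.inr hx
  · left
    refine coneX_core _ _ hx ?_
    rcases lt_or_ge |v.1 1| |adapted m v.1| with h | h
    · exact Or.inl h
    · exact Or.inr ⟨h, hv h⟩

/-- `T(m)⁻¹ • (X m)ᶜ ⊆ Y m`. -/
theorem inv_smul_compl_coneX_subset (m : ℤ) : (genMat m)⁻¹ • (coneX m)ᶜ ⊆ coneY m := by
  rintro _ ⟨v, hv, rfl⟩
  simp only [Set.mem_compl_iff, coneX, Set.mem_setOf_eq, not_or, not_and, not_lt] at hv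
  obtain ⟨hv1, hx⟩ := hv
  show |adapted m ((genMat m)⁻¹ • v).1| ≤ |((genMat m)⁻¹ • v).1 1| ∧
      adapted m ((genMat m)⁻¹ • v).1 * ((genMat m)⁻¹ • v).1 1 < 0
  rw [SubMulAction.val_smul, adapted_inv_smul, snd_inv_smul]
  refine coneY_core _ _ hx ?_
  rcases lt_or_ge |v.1 1| |adapted m v.1| with h | h
  · exact Or.inl h
  · exact Or.inr ⟨h, hv1 h⟩

/-! ## Freeness -/

/-- The parameters `4(j+1)` of distinct generators are at least `4 ≥ 3` apart. -/
theorem gen_param_far {D : ℕ} {j k : Fin D} (hjk : j ≠ k) :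
    3 ≤ |4 * ((j : ℤ) + 1) - 4 * ((k : ℤ) + 1)| := by
  have : (j : ℤ) ≠ (k : ℤ) := fun h => hjk (Fin.ext (by exact_mod_cast h))
  rcases lt_or_gt_of_ne this with h | h
  · rw [abs_of_neg (by linarith)]; linarith
  · rw [abs_of_pos (by linarith)]; linarith

/-- **Free subgroup of `SL(2,ℤ)` of rank `D` (Schottky ping-pong).**  The homomorphism from the
free group on `Fin D` sending the `j`-th generator to `T(4(j+1))` is injective. -/
theorem injective_lift_gen (D : ℕ) (hD : 2 ≤ D) : Function.Injective (FreeGroup.lift (gen D)) := by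
  haveI : Nontrivial (Fin D) := Fin.nontrivial_iff_two_le.mpr hD
  refine FreeGroup.injective_lift_of_ping_pong (gen D)
    (fun j => coneX (4 * ((j : ℤ) + 1))) (fun j => coneY (4 * ((j : ℤ) + 1)))
    (fun j => coneX_nonempty _) ?_ ?_ ?_ ?_ ?_
  · intro j k hjk
    exact disjoint_of_far (gen_param_far hjk) _ _ (Or.inl rfl) (Or.inl rfl)
  · intro j k hjk
    exact disjoint_of_far (gen_param_far hjk) _ _ (Or.inr rfl) (Or.inr rfl)
  · intro j k
    by_cases hjk : j = k
    · subst hjk; exact disjoint_coneX_coneY_self _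
    · exact disjoint_of_far (gen_param_far hjk) _ _ (Or.inl rfl) (Or.inr rfl)
  · intro j; exact smul_compl_coneY_subset _
  · intro j; rw [Pi.inv_apply]; exact inv_smul_compl_coneX_subset _

end Summit.ValiantsHypothesis.ValiantsHypothesis.Theorems.PeelingLemmaSchottky
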